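import Literature.Computability.QuantumComplexity.NetCompilerSpec
import Literature.Computability.Cryptography.QuantumCircuit
import HarnessLib

/-!
# The effective compiler: parameters and soundness (effective compiler, IV)

Fourth file of the effective gate compiler behind `PromiseBQPOver_eq_PromiseBQP`: the net compiler of
`NetCompilerSpec.lean` is instantiated with explicit parameters — all powers of two, so that every
division of the analysis is exact — and proved SOUND at every accuracy level.

* `Data G m` — the static data of the compiler of one target unitary `U` on the `m`-qubit register
  over the gate set `G`: an enumeration `pl` of placements (the generators), dyadic Gaussian names of
  the generator and target entries (`gname i x y p ≈ 2ᵖ ·` entry), and natural bounds `2^{cQ} ≥ C`,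
  `cc ≥ c` on the Solovay–Kitaev constants; `Data.Valid D U` — the names are `2/2ᵖ`-accurate, `U` is
  unitary, and at every level `k` some word of length `≤ 2^{qExp k}` over the generators is within
  `1/(8·2ᵏ)` of `U` up to phase (the Solovay–Kitaev input in power-of-two form).
* **Parameters** as functions of the level `k` (`N = 2ᵏ`): `Q = 2^{qExp}` (`= 2^{cQ + cc(3+m+k)}`),
  separation `T = 2^{tExp} = 16 N Q`, `2^{pbExp} ≥ packBound`, rounds `R = 2^{rExp} = 2·2^{pbExp}`,
  mesh `h = 2^{hExp}`, precision `p = prec k` with `2ᵖ = 2·2ᵐ·T·h = 32·4ᵐ·T·R` (`two_pow_prec`,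
  `two_pow_prec'`); the run parameters `params k`, `gens k`, `tgt k`, the compiled index word
  `wordIdx k` (lookup at threshold `1/(2N)`) and circuit `wordCirc k` (`gateOf`, `genU`).
* **The inequalities**: `approximates` (`η = 2·2ᵐ/2ᵖ`), `packBound_le`, `good` (`Params.Good`),
  `rounds_mul_rho_le` (`(R+1)ρ ≤ 1/(4T)`), `eta_le`.
* **`sound_level`**: for valid data, `∃ c, ‖c‖ = 1 ∧ ImplOn univ ((wordCirc k).toMatrix 0) (c • U) 2⁻ᵏ`
  — `compile_spec` with the Solovay–Kitaev word (`D(U, v) ≤ 1/(8N)`, `|v| θ ≤ 6/(64N)`,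
  `η, (R+1)ρ ≤ 1/(64NQ)`, total `≤ 1/(4N) ≤ 1/TT`), then `D(U, w) ≤ 1/(2N) + 2/(64N) < 1/N` and the
  bridge `exists_implOn_of_phaseDist_le` of `PhaseFrobenius.lean`.

Everything is proved; no named facts. The existence of valid data for the placements of a universal
gate set, and the assembly into a `GateCompiler`, are in `EffectiveCompilation.lean`; polynomial time
in `N` (exponential in `k`) of `N ↦ wordCirc ⌊log₂ N⌋` is `EffectiveCompilerFP.lean`.

## References

* C. M. Dawson, M. A. Nielsen, *The Solovay–Kitaev algorithm*, Quantum Inf. Comput. 6 (2006),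
  Thm. 1 and §5 [DawsonNielsen2006].
* M. A. Nielsen, I. L. Chuang, *Quantum Computation and Quantum Information*, CUP 2010, §4.5.3
  (Box 4.1) [NielsenChuang2010].
* E. Bernstein, U. Vazirani, *Quantum complexity theory*, SIAM J. Comput. 26 (1997), §6 (dyadic
  approximations of amplitudes) [BernsteinVazirani1997].
-/

noncomputable section

namespace Literature.Computability.QuantumComplexity

open Matrix Cryptography PhaseFrobenius GaussianInt

namespace NetCompiler

variable {G : QGateSet} {m : ℕ}

/-- `|QReg m| = 2ᵐ` (the same one-liner as `card_QReg` of `PostBQPSign.lean`, which is not imported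
here to keep the import closure of the compiler light). [folklore] -/
theorem card_QReg_eq (m : ℕ) : Fintype.card (QReg m) = 2 ^ m := by simp [QReg]

/-! ### The data of the compiler for one target -/

/-- **The static data of the compiler of one target unitary** on the `m`-qubit register over the
gate set `G`: an enumeration `pl` of the placements used as generators (with a default one), the
dyadic names of the generator entries (`gname i x y p ≈ 2ᵖ · (placement i)_{xy}`) and of the target
entries, and two natural constants bounding the Solovay–Kitaev word length (`2^{cQ} ≥ C`,
`cc ≥ c`). [cite: DawsonNielsen2006, §5] -/
structure Data (G : QGateSet) (m : ℕ) where
  /-- the generators: placements of gates of `G` on `m` wires -/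
  pl : List (Σ h : G.Op, Fin (G.arity h) ↪ Fin m)
  /-- a default placement -/
  dflt : Σ h : G.Op, Fin (G.arity h) ↪ Fin m
  /-- dyadic names of the generator entries -/
  gname : ℕ → QReg m → QReg m → ℕ → GaussianInt
  /-- dyadic names of the target entries -/
  tname : QReg m → QReg m → ℕ → GaussianInt
  /-- `2^{cQ}` bounds the Solovay–Kitaev constant `C` -/
  cQ : ℕ
  /-- `cc` bounds the Solovay–Kitaev exponent `c` -/
  cc : ℕ

namespace Data

variable (D : Data G m)

/-! ### Parameters (all powers of two, as functions of the accuracy level `k`) -/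

/-- Exponent of `Q = 2^{qExp}`, the bound on the Solovay–Kitaev word length at accuracy
`ε = 2^{-(3+m+k)}`. [folklore] -/
def qExp (k : ℕ) : ℕ := D.cQ + D.cc * (3 + m + k)

/-- Exponent of the separation threshold `T = 2^{tExp} = 16 · 2ᵏ · Q`. [folklore] -/
def tExp (k : ℕ) : ℕ := 4 + k + D.qExp k

/-- Exponent of the bound `2^{pbExp} ≥ packBound` on the size of the net. [folklore] -/
def pbExp (k : ℕ) : ℕ := (3 + 2 * m + D.tExp k) * (2 * (2 ^ m * 2 ^ m))

/-- Exponent of the number of rounds `R = 2^{rExp} = 2 · 2^{pbExp}`. [folklore] -/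
def rExp (k : ℕ) : ℕ := D.pbExp k + 1

/-- Exponent of the mesh `h = 2^{hExp}` of the packing analysis. [folklore] -/
def hExp (k : ℕ) : ℕ := 4 + m + D.rExp k

/-- **The precision** `p = 1 + m + tExp + hExp` (so that `2ᵖ = 2 · 2ᵐ · T · h` exactly). [folklore] -/
def prec (k : ℕ) : ℕ := 1 + m + D.tExp k + D.hExp k

/-- The `i`-th generator matrix at level `k` (entries named at precision `p`). [folklore] -/
def genMat (k i : ℕ) : GMat m := Matrix.of fun x y => D.gname i x y (D.prec k)

/-- The generator list at level `k`. [folklore] -/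
def gens (k : ℕ) : List (GMat m) := (List.range D.pl.length).map (D.genMat k)

/-- The target matrix at level `k`. [folklore] -/
def tgt (k : ℕ) : GMat m := Matrix.of fun x y => D.tname x y (D.prec k)

/-- The run parameters at level `k`. [folklore] -/
def params (k : ℕ) : Params m := ⟨D.prec k, 2 ^ D.tExp k, D.gens k⟩

/-- The number of rounds at level `k`. [folklore] -/
def rounds (k : ℕ) : ℕ := 2 ^ D.rExp k

/-- **The compiled index word at level `k`**: `R` rounds of net construction, then the lookup of the
target at threshold `1/(2 · 2ᵏ)`. [cite: DawsonNielsen2006, §5] -/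
def wordIdx (k : ℕ) : List ℕ := (D.params k).compile (D.rounds k) (2 ^ (k + 1)) (D.tgt k)

/-- The placed gate of generator `i`. [folklore] -/
def gateOf (i : ℕ) : QGate G m := QGate.gate (D.pl.getD i D.dflt).1 (D.pl.getD i D.dflt).2

/-- **The compiled circuit at level `k`.** [cite: DawsonNielsen2006, §5] -/
def wordCirc (k : ℕ) : QCircuit G m := ⟨(D.wordIdx k).map D.gateOf⟩

/-- The unitary of generator `i` (the matrix of the placed gate). [folklore] -/
def genU (i : ℕ) : Matrix (QReg m) (QReg m) ℂ := (D.gateOf i).toMatrix 0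

/-- The compiled circuit is oracle-free. [folklore] -/
theorem isOracleFree_wordCirc (k : ℕ) : (D.wordCirc k).IsOracleFree := by
  intro γ hγ
  simp only [wordCirc, List.mem_map] at hγ
  obtain ⟨i, -, rfl⟩ := hγ
  trivial

/-- **The matrix of the compiled circuit is the word matrix** of its index word. [folklore] -/
theorem toMatrix_wordCirc (k : ℕ) (A : Language Bool) :
    (D.wordCirc k).toMatrix A = wmat (fun i => (D.gateOf i).toMatrix A) (D.wordIdx k) := by
  simp [wordCirc, QCircuit.toMatrix, wmat, List.map_reverse]
  rfl

/-- The matrix of a placed gate does not depend on the oracle. [folklore] -/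
theorem toMatrix_gateOf (i : ℕ) (A : Language Bool) : (D.gateOf i).toMatrix A = D.genU i := rfl

/-! ### Validity of the data -/

/-- **Valid data for the target `U`**: the register is genuine, the gate set is unitary, the names
are `2/2ᵖ`-accurate dyadic approximations of the generator and target entries, the target is
unitary, and at every level some short word over the generators approximates the target up to
phase (the Solovay–Kitaev input, with its length bound in the form `|v| ≤ 2^{qExp k}`).
[cite: DawsonNielsen2006, Thm. 1] -/
structure Valid (D : Data G m) (U : Matrix (QReg m) (QReg m) ℂ) : Prop where
  /-- at least one wire -/
  m_pos : 1 ≤ m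
  /-- the gate set is unitary -/
  unitary : G.IsUnitary
  /-- the generator names are accurate -/
  gname_spec : ∀ i < D.pl.length, ∀ (x y : QReg m) (p : ℕ),
    ‖((2 : ℂ) ^ p)⁻¹ * toComplex (D.gname i x y p) - D.genU i x y‖ ≤ 2 / 2 ^ p
  /-- the target names are accurate -/
  tname_spec : ∀ (x y : QReg m) (p : ℕ), ‖((2 : ℂ) ^ p)⁻¹ * toComplex (D.tname x y p) - U x y‖ ≤ 2 / 2 ^ p
  /-- the target is unitary -/
  U_mem : U ∈ Matrix.unitaryGroup (QReg m) ℂ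
  /-- short words approximate the target up to phase (Solovay–Kitaev) -/
  sk : ∀ k : ℕ, ∃ v : List ℕ, (∀ i ∈ v, i < D.pl.length) ∧ v.length ≤ 2 ^ D.qExp k ∧
    phaseDist U (wmat D.genU v) ≤ 1 / (8 * 2 ^ k)

end Data

namespace Data

variable {D : Data G m} {U : Matrix (QReg m) (QReg m) ℂ}

/-! ### Unfolding the parameters -/

/-- The precision of the run parameters (definitional). [folklore] -/
@[simp] theorem params_p (D : Data G m) (k : ℕ) : (D.params k).p = D.prec k := rfl

/-- The threshold of the run parameters (definitional). [folklore] -/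
@[simp] theorem params_T (D : Data G m) (k : ℕ) : (D.params k).T = 2 ^ D.tExp k := rfl

/-- The generators of the run parameters (definitional). [folklore] -/
@[simp] theorem params_gens (D : Data G m) (k : ℕ) : (D.params k).gens = D.gens k := rfl

/-- There are as many generator matrices as placements. [folklore] -/
@[simp] theorem length_gens (D : Data G m) (k : ℕ) : (D.gens k).length = D.pl.length := by simp [gens]

/-- The `i`-th generator matrix. [folklore] -/
theorem gens_getD (D : Data G m) (k : ℕ) {i : ℕ} (hi : i < D.pl.length) : (D.gens k).getD i 0 = D.genMat k i := by
  rw [gens, List.getD_eq_getElem _ _ (by simpa using hi), List.getElem_map, List.getElem_range]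

/-- The generator unitaries are unitary. [folklore] -/
theorem genU_mem_unitaryGroup (hV : D.Valid U) (i : ℕ) : D.genU i ∈ Matrix.unitaryGroup (QReg m) ℂ :=
  QGate.toMatrix_mem_unitaryGroup_holds hV.unitary 0 _

/-- **The name tolerance** `η = 2 · 2ᵐ / 2ᵖ` at level `k`. [folklore] -/
def eta (D : Data G m) (k : ℕ) : ℝ := 2 * Fintype.card (QReg m) / 2 ^ D.prec k

/-- `η ≥ 0`. [folklore] -/
theorem eta_nonneg (D : Data G m) (k : ℕ) : 0 ≤ D.eta k := by unfold eta; positivity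

/-- Entries of a represented matrix. [folklore] -/
theorem hat_apply (p : ℕ) (X : GMat m) (x y : QReg m) : hat p X x y = ((2 : ℂ) ^ p)⁻¹ * toComplex (X x y) := by
  simp [hat, Matrix.smul_apply]

/-- **The generator matrices represent the generator unitaries within `η`.** [folklore] -/
theorem fro_hat_genMat_sub_le (hV : D.Valid U) (k : ℕ) {i : ℕ} (hi : i < D.pl.length) :
    fro (hat (D.prec k) (D.genMat k i) - D.genU i) ≤ D.eta k := by
  have h := fro_le_card_mul (hat (D.prec k) (D.genMat k i) - D.genU i) (b := 2 / 2 ^ D.prec k) (by positivity)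
    fun x y => by
      rw [Matrix.sub_apply, hat_apply, genMat, Matrix.of_apply]
      exact hV.gname_spec i hi x y (D.prec k)
  refine h.trans (le_of_eq ?_)
  unfold eta; ring

/-- **The target matrix represents the target within `η`.** [folklore] -/
theorem fro_hat_tgt_sub_le (hV : D.Valid U) (k : ℕ) : fro (hat (D.prec k) (D.tgt k) - U) ≤ D.eta k := by
  have h := fro_le_card_mul (hat (D.prec k) (D.tgt k) - U) (b := 2 / 2 ^ D.prec k) (by positivity)
    fun x y => by
      rw [Matrix.sub_apply, hat_apply, tgt, Matrix.of_apply]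
      exact hV.tname_spec x y (D.prec k)
  refine h.trans (le_of_eq ?_)
  unfold eta; ring

/-- **The run parameters approximate the generator unitaries.** [folklore] -/
theorem approximates (hV : D.Valid U) (k : ℕ) : (D.params k).Approximates D.genU (D.eta k) where
  nonneg := D.eta_nonneg k
  unitary i _ := genU_mem_unitaryGroup hV i
  approx i hi := by
    rw [params_gens, length_gens] at hi
    rw [params_p, params_gens, D.gens_getD k hi]
    exact fro_hat_genMat_sub_le hV k hi

/-! ### The parameter inequalities -/

/-- `2 ≤ 2ᵐ`. [folklore] -/
theorem two_le_card (hm : 1 ≤ m) : (2 : ℝ) ≤ Fintype.card (QReg m) := by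
  rw [card_QReg_eq]
  have h : 2 ^ 1 ≤ 2 ^ m := Nat.pow_le_pow_right (by norm_num) hm
  exact_mod_cast h

/-- `T = 16 · 2ᵏ · Q`. [folklore] -/
theorem two_pow_tExp (D : Data G m) (k : ℕ) : (2 : ℝ) ^ D.tExp k = 16 * 2 ^ k * 2 ^ D.qExp k := by
  rw [tExp, pow_add, pow_add]; norm_num

/-- `2ᵖ = 32 · 4ᵐ · T · R` (the precision absorbs the error accumulated over `R` rounds). [folklore] -/
theorem two_pow_prec (D : Data G m) (k : ℕ) :
    (2 : ℝ) ^ D.prec k = 32 * ((Fintype.card (QReg m) : ℝ) * Fintype.card (QReg m)) * 2 ^ D.tExp k * 2 ^ D.rExp k := by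
  rw [card_QReg_eq, prec, hExp]
  push_cast
  simp only [pow_add]
  ring

/-- `2ᵖ = 2 · 2ᵐ · h · T` (far matrices get different cells, exactly). [folklore] -/
theorem two_pow_prec' (D : Data G m) (k : ℕ) :
    (2 : ℝ) ^ D.prec k = 2 * (Fintype.card (QReg m) : ℝ) * (2 ^ D.hExp k : ℕ) * 2 ^ D.tExp k := by
  rw [card_QReg_eq, prec]
  push_cast
  simp only [pow_add]
  ring

/-- **The accumulated error is small**: `(R + 1) ρ ≤ 1/(4T)`. [folklore] -/
theorem rounds_mul_rho_le (hm : 1 ≤ m) (D : Data G m) (k : ℕ) :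
    ((D.rounds k : ℝ) + 1) * (D.params k).rho (D.eta k) ≤ 1 / (4 * 2 ^ D.tExp k) := by
  set d : ℝ := (Fintype.card (QReg m) : ℝ) with hd
  have hd2 : 2 ≤ d := two_le_card hm
  have hrho : (D.params k).rho (D.eta k) = 2 * d * (d + 2) / 2 ^ D.prec k := by
    simp only [Params.rho, eta, params_p, ← hd]
    ring
  have hR : (D.rounds k : ℝ) = 2 ^ D.rExp k := by simp [rounds]
  rw [hrho, hR, D.two_pow_prec k, ← hd]
  have hT : (0 : ℝ) < 2 ^ D.tExp k := by positivity
  have hRpos : (1 : ℝ) ≤ 2 ^ D.rExp k := one_le_pow₀ (by norm_num)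
  rw [← mul_div_assoc, div_le_div_iff₀ (by positivity) (by positivity), one_mul]
  -- `(R + 1) · 2 d (d + 2) · 4 T ≤ 32 d² T R`
  have h1 : (2 : ℝ) ^ D.rExp k + 1 ≤ 2 * 2 ^ D.rExp k := by linarith
  have h2 : d + 2 ≤ 2 * d := by linarith
  have h3 : ((2 : ℝ) ^ D.rExp k + 1) * (d + 2) ≤ (2 * 2 ^ D.rExp k) * (2 * d) :=
    mul_le_mul h1 h2 (by positivity) (by positivity)
  calc ((2 : ℝ) ^ D.rExp k + 1) * (2 * d * (d + 2)) * (4 * 2 ^ D.tExp k)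
      = (8 * d * 2 ^ D.tExp k) * (((2 : ℝ) ^ D.rExp k + 1) * (d + 2)) := by ring
    _ ≤ (8 * d * 2 ^ D.tExp k) * ((2 * 2 ^ D.rExp k) * (2 * d)) := mul_le_mul_of_nonneg_left h3 (by positivity)
    _ = 32 * (d * d) * 2 ^ D.tExp k * 2 ^ D.rExp k := by ring

/-- **The name tolerance is small**: `η ≤ 1/(4T)`. [folklore] -/
theorem eta_le (hm : 1 ≤ m) (D : Data G m) (k : ℕ) : D.eta k ≤ 1 / (4 * 2 ^ D.tExp k) := by
  set d : ℝ := (Fintype.card (QReg m) : ℝ) with hd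
  have hd2 : 2 ≤ d := two_le_card hm
  rw [eta, D.two_pow_prec k, ← hd, div_le_div_iff₀ (by positivity) (by positivity)]
  have hRpos : (1 : ℝ) ≤ 2 ^ D.rExp k := one_le_pow₀ (by norm_num)
  rw [one_mul]
  have h1 : (1 : ℝ) ≤ 4 * d * 2 ^ D.rExp k := by nlinarith
  calc 2 * d * (4 * (2 : ℝ) ^ D.tExp k) = (8 * d * 2 ^ D.tExp k) * 1 := by ring
    _ ≤ (8 * d * 2 ^ D.tExp k) * (4 * d * 2 ^ D.rExp k) := mul_le_mul_of_nonneg_left h1 (by positivity)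
    _ = 32 * (d * d) * 2 ^ D.tExp k * 2 ^ D.rExp k := by ring

end Data

namespace Data

variable {D : Data G m} {U : Matrix (QReg m) (QReg m) ℂ}

/-- **The net stays within the round budget**: `packBound h ≤ 2^{pbExp}` at mesh `h = 2^{hExp}`
(`2B/h = 4 · 2ᵐ (2ᵐ + 1) T` exactly, and `4d(d+1)T + 1 ≤ 8 d² T`). [folklore] -/
theorem packBound_le (hm : 1 ≤ m) (D : Data G m) (k : ℕ) : (D.params k).packBound (2 ^ D.hExp k) ≤ 2 ^ D.pbExp k := by
  have hcard : Fintype.card (QReg m) = 2 ^ m := card_QReg_eq m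
  have hd2 : 2 ≤ 2 ^ m :=
    calc 2 = 2 ^ 1 := rfl
      _ ≤ 2 ^ m := Nat.pow_le_pow_right (by norm_num) hm
  have hB : (D.params k).B = (((2 ^ m + 1) * 2 ^ D.prec k : ℕ) : ℤ) := by
    simp [Params.B, hcard]
  have hdiv : 2 * (D.params k).B / ((2 ^ D.hExp k : ℕ) : ℤ) = ((4 * 2 ^ m * (2 ^ m + 1) * 2 ^ D.tExp k : ℕ) : ℤ) := by
    rw [hB]
    have h2 : (2 : ℤ) * (((2 ^ m + 1) * 2 ^ D.prec k : ℕ) : ℤ) =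
        ((4 * 2 ^ m * (2 ^ m + 1) * 2 ^ D.tExp k : ℕ) : ℤ) * ((2 ^ D.hExp k : ℕ) : ℤ) := by
      push_cast
      rw [prec]
      simp only [pow_add]
      ring
    rw [h2, Int.mul_ediv_cancel _ (by positivity)]
  unfold Params.packBound
  rw [hdiv, Int.toNat_natCast, pbExp, hcard,
    show (2 : ℕ) ^ ((3 + 2 * m + D.tExp k) * (2 * (2 ^ m * 2 ^ m))) =
      (2 ^ (3 + 2 * m + D.tExp k)) ^ (2 * (2 ^ m * 2 ^ m)) from pow_mul _ _ _]
  apply Nat.pow_le_pow_left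
  have h8 : 2 ^ (3 + 2 * m + D.tExp k) = 8 * (2 ^ m * 2 ^ m) * 2 ^ D.tExp k := by
    rw [pow_add, pow_add, two_mul, pow_add]; ring
  rw [h8]
  have hT : 1 ≤ 2 ^ D.tExp k := Nat.one_le_two_pow
  set d : ℕ := 2 ^ m
  set T : ℕ := 2 ^ D.tExp k
  have h1 : 2 * (d * T) ≤ d * (d * T) := Nat.mul_le_mul_right _ hd2
  have h2 : 1 ≤ d * T := Nat.one_le_iff_ne_zero.2 (Nat.mul_ne_zero (by omega) (by omega))
  nlinarith [h1, h2]

/-- **The parameters are adequate** (`Params.Good`) at every level. [folklore] -/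
theorem good (hV : D.Valid U) (k : ℕ) : (D.params k).Good (D.eta k) (D.rounds k) (2 ^ D.hExp k) where
  T_pos := by rw [params_T]; positivity
  h_pos := by positivity
  sep := by
    rw [params_T, params_p, D.two_pow_prec' k]
    push_cast
    exact le_rfl
  rounds := by
    rw [rounds, rExp, pow_succ]
    have := packBound_le hV.m_pos D k
    omega
  small := by
    refine (rounds_mul_rho_le hV.m_pos D k).trans ?_
    rw [div_le_one (by positivity)]
    have : (1 : ℝ) ≤ 2 ^ D.tExp k := one_le_pow₀ (by norm_num)
    linarith

/-! ### Soundness -/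

/-- **Soundness of the effective compiler at level `k`.** For valid data, the compiled circuit
implements the target up to a global phase with operator-norm error `2⁻ᵏ`:
the net built in `R = 2^{rExp}` rounds at separation `1/T`, `T = 16 · 2ᵏ · Q`, approximates every
generator word of length `≤ Q` within `3/(32 · 2ᵏ)` up to phase, in particular the Solovay–Kitaev
word of the target; the lookup at threshold `1/(2 · 2ᵏ)` then returns a stored word within
`1/(2·2ᵏ) + 2/(64·2ᵏ) < 2⁻ᵏ` of the target, and a Frobenius bound up to phase is an `ImplOn` bound.
[cite: DawsonNielsen2006, Thm. 1 and §5] [cite: NielsenChuang2010, §4.5.3 Box 4.1] -/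
theorem sound_level (hV : D.Valid U) (k : ℕ) :
    ∃ c : ℂ, ‖c‖ = 1 ∧ ImplOn Set.univ ((D.wordCirc k).toMatrix 0) (c • U) ((1 / 2 : ℝ) ^ k) := by
  -- the quantities
  set N : ℝ := 2 ^ k with hN
  set Q : ℝ := 2 ^ D.qExp k with hQ
  set T : ℝ := 2 ^ D.tExp k with hT
  set E : ℝ := ((D.rounds k : ℝ) + 1) * (D.params k).rho (D.eta k) with hE
  have hNpos : 0 < N := by positivity
  have hQ1 : 1 ≤ Q := one_le_pow₀ (by norm_num)
  have hTNQ : T = 16 * N * Q := D.two_pow_tExp k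
  have hE_le : E ≤ 1 / (4 * T) := rounds_mul_rho_le hV.m_pos D k
  have hη_le : D.eta k ≤ 1 / (4 * T) := eta_le hV.m_pos D k
  have hEnn : 0 ≤ E := mul_nonneg (by positivity) ((D.params k).rho_nonneg (D.eta_nonneg k))
  have hηnn := D.eta_nonneg k
  -- `1/(4T) = u`, `1/(64 N) = w`, `u ≤ w`, `Q u = w`, `Q / T = 4 w`
  set u : ℝ := 1 / (4 * T) with hu
  set w : ℝ := 1 / (64 * N) with hw
  have hQu : Q * u = w := by rw [hu, hw, hTNQ]; field_simp; ring
  have huw : u ≤ w := by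
    rw [← hQu]; exact le_mul_of_one_le_left (by rw [hu]; positivity) hQ1
  have hQT : Q / T = 4 * w := by rw [hw, hTNQ]; field_simp; ring
  have hTT : (1 : ℝ) / ((2 ^ (k + 1) : ℕ) : ℝ) = 32 * w := by rw [hw, hN]; push_cast; rw [pow_succ]; field_simp; ring
  -- the ingredients of `compile_spec`
  have hP := approximates hV k
  have hG := good hV k
  have htgt := fro_hat_tgt_sub_le hV k
  obtain ⟨v, hv, hvlen, hvdist⟩ := hV.sk k
  have hvlen' : (v.length : ℝ) ≤ Q := by rw [hQ]; exact_mod_cast hvlen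
  have hθ : (D.params k).theta (D.eta k) (D.rounds k) = 1 / T + 2 * E := by
    simp only [Params.theta, params_T, hE, hT]; push_cast; ring
  have hvθ : (v.length : ℝ) * (D.params k).theta (D.eta k) (D.rounds k) ≤ 4 * w + 2 * w := by
    rw [hθ]
    calc (v.length : ℝ) * (1 / T + 2 * E) ≤ Q * (1 / T + 2 * E) := by gcongr
      _ = Q / T + 2 * (Q * E) := by ring
      _ ≤ 4 * w + 2 * w := by
          rw [hQT]
          have : Q * E ≤ Q * u := mul_le_mul_of_nonneg_left hE_le (by positivity)
          linarith
  have hsum : phaseDist U (wmat D.genU v) + v.length * (D.params k).theta (D.eta k) (D.rounds k) + D.eta k + E ≤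
      1 / ((2 ^ (k + 1) : ℕ) : ℝ) := by
    rw [hTT]
    have h8 : phaseDist U (wmat D.genU v) ≤ 8 * w := by
      refine hvdist.trans (le_of_eq ?_); rw [hw, hN]; field_simp; ring
    linarith
  have hspec := (D.params k).compile_spec hP hG (TT := 2 ^ (k + 1)) (by positivity) htgt
    ⟨v, by rwa [params_gens, length_gens], hsum⟩
  obtain ⟨-, -, hdist⟩ := hspec
  -- the compiled circuit
  have hmat : (D.wordCirc k).toMatrix 0 = wmat D.genU (D.wordIdx k) := D.toMatrix_wordCirc k 0
  have hfinal : phaseDist ((D.wordCirc k).toMatrix 0) U ≤ (1 / 2 : ℝ) ^ k := by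
    rw [hmat, phaseDist_comm]
    refine hdist.trans ?_
    rw [hTT]
    have hk : (1 / 2 : ℝ) ^ k = 64 * w := by rw [hw, hN, one_div, inv_pow]; field_simp
    rw [hk]
    linarith
  exact exists_implOn_of_phaseDist_le hfinal

end Data

end NetCompiler

end Literature.Computability.QuantumComplexity

end
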